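import Literature.MathematicalPhysics.QuantumLattice.LowdinSpinProjection
import Literature.MathematicalPhysics.QuantumLattice.FockRelabel
import Literature.MathematicalPhysics.QuantumLattice.NonorthogonalSlaterKernels
import Literature.MathematicalPhysics.QuantumLattice.FreeFermionTwistedTraceFormula
import HarnessLib

/-!
# The symmetry operators of projected-determinant states are second quantisations

Topic `Literature/MathematicalPhysics/QuantumLattice`, family `hubbard`; namespace
`Literature.MathematicalPhysics.QuantumLattice.SlaterKernel` (companion of `NonorthogonalSlaterKernels`).
Everything is PROVED; two definitions with bodies (`permOneBody`, `spinYOneBody`), no named fact.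

Symmetry-projected Hartree–Fock / "projected-determinant" trial states (Rodríguez-Guzmán et al. 2012, §II and
App. A) are built by applying to a Slater determinant the lattice symmetry operations `R̂(g)`, `T̂_j` and the
spin rotation `e^{-iβŜ_y}`, and every kernel is then evaluated "in the rotated single-particle basis", i.e. by
letting the ONE-BODY permutation / rotation matrix act on the orbital matrix of the determinant. The operator
identity behind this practice is that these Fock-space unitaries are second quantisations `Γ(u)` of one-body
matrices `u` (Bratteli–Robinson II, Thm. 5.2.5: Bogoliubov transformations by one-particle unitaries are
implemented by `Γ`), so that `Γ(u) Γ(h)|T⟩ = Γ(u h)|T⟩` (`SlaterKernel.Gamma_mulVec_col_Gamma`). Here: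

* `fockRelabel_val_eq_Gamma` — the tree's orbital-permutation unitary `U_π` (`FockRelabel`; the lattice
  representation `SymmetryProjection.latticeRep` is `U_{π g}`) IS `Γ(P_π)`, `P_π e_j = e_{π j}`
  (`permOneBody`), by the cyclicity-of-the-vacuum uniqueness `fockRelabel_unique`;
* `spinRotY_eq_Gamma` — the tree's global spin rotation `R_y(β) = e^{-iβS_y}`
  (`LowdinProjection.spinRotY`, `spinRotY_eq_exp`) IS `Γ(cos(β/2)·1 − sin(β/2)·J)` with
  `J = Σ_x (E_{x↑,x↓} − E_{x↓,x↑})` (`spinYOneBody`, `dΓ(J) = S⁺ − S⁻`, `J² = −1`), i.e. `Γ` of the block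
  rotation `[[cos β/2, −sin β/2],[sin β/2, cos β/2]]` on every site's spinor — via `e^{dΓ(A)} = Γ(e^A)`
  (`exp_dGamma_eq_Gamma_exp`) and the summed exponential series `e^{θJ} = cos θ + sin θ J`;
* `hubbard_kernel_perm_spinRot`, `overlap_perm_spinRot_eq_det` — consequently the Hamiltonian and overlap
  kernels between `Φ_g` and `U_π R_y(β) Φ_h` are the determinant-pair kernels of `NonorthogonalSlaterKernels`
  (`hubbard_kernel_eq`, `overlap_eq_det_overlapMatrix`) for the transformed orbital matrix
  `P_π (cos(β/2)·1 − sin(β/2)·J) h` [RodriguezGuzmanEtAl2012 App. A: "gauge-rotated" kernels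
  `n^{ik}(Ω,j) = det 𝒳^{ik}(Ω,j)`, `𝒳^{ik} = 𝒟^{iT} 𝒮(Ω,j) 𝒟^{k*}`, `𝒮 = 𝒟^{1/2}(Ω) e^{ik_α j}`].

With `SymmetryProjectedVariationalBound` (the projected Rayleigh-quotient bound), `LowdinSpinProjection`
(`½∫ sin β R_y(β) dβ = P_{S=0}` on `S^z = 0`) and `NonorthogonalSlaterKernels` (Löwdin's rules) this makes the
symmetry-projected (multi-)determinant upper-bound certificates of the many-body-bootstrap cell kernel-checked
down to the exact-rational evaluation of determinants of explicit integer matrices.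

## References

* R. Rodríguez-Guzmán, K. W. Schmid, C. A. Jiménez-Hoyos, G. E. Scuseria, Phys. Rev. B 85 (2012) 245130,
  §II eq. (5) and Appendix A. [RodriguezGuzmanEtAl2012]
* O. Bratteli, D. W. Robinson, *Operator Algebras and Quantum Statistical Mechanics 2*, 2nd ed. (1997),
  §5.2.1–§5.2.2, Thm. 5.2.5. [BratteliRobinsonII1997]
* J. Dereziński, C. Gérard, *Mathematics of Quantization and Quantum Fields* (2013/2022), Prop. 3.23,
  Prop. 3.53 (1). [DerezinskiGerard2022]
-/

noncomputable section

namespace Literature.MathematicalPhysics.QuantumLattice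

namespace SlaterKernel

open Matrix Finset RayleighBound

variable {ι : Type*} [LinearOrder ι] [Fintype ι]

/-! ### §1. Orbital permutations -/

/-- The one-particle permutation matrix `P_π e_j = e_{π j}`. [cite: BratteliRobinsonII1997, §5.2.2, Thm. 5.2.5] -/
def permOneBody (π : Equiv.Perm ι) : Matrix ι ι ℂ := Matrix.of fun i j => if i = π j then 1 else 0

/-- **The orbital-permutation unitary is a second quantisation**: `U_π = Γ(P_π)` with `P_π e_j = e_{π j}`
(both intertwine `c†_j ↦ c†_{π j}` and fix the vacuum; cyclicity of the vacuum).
[cite: BratteliRobinsonII1997, §5.2.2, Thm. 5.2.5] [cite: DerezinskiGerard2022, Prop. 3.53 (1)] -/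
theorem fockRelabel_val_eq_Gamma (π : Equiv.Perm ι) : (fockRelabel π).val = Gamma (permOneBody π) := by
  symm
  refine fockRelabel_unique π _ (fun j => ?_) (Gamma_mulVec_vacuum _)
  rw [Gamma_mul_creation]
  congr 1
  simp only [create, permOneBody, of_apply, ite_smul, one_smul, zero_smul, sum_ite_eq', mem_univ, if_true]

/-! ### §2. The spin rotation `e^{-iβS_y}` -/

section Spin

variable {Λ : Type*} [LinearOrder Λ] [Fintype Λ]

/-- The one-body generator of the spin rotations about `y`: `J = Σ_x (E_{x↑,x↓} − E_{x↓,x↑})`, the matrix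
with `dΓ(J) = S⁺ − S⁻ = 2i S_y`. [cite: RodriguezGuzmanEtAl2012, §II eq. (5)] -/
def spinYOneBody : Matrix (Orb Λ) (Orb Λ) ℂ :=
  ∑ x : Λ, (Matrix.single (orb x 0) (orb x 1) (1 : ℂ) - Matrix.single (orb x 1) (orb x 0) (1 : ℂ))

/-- `dΓ` is additive over finite sums. [cite: BratteliRobinsonII1997, §5.2.1] -/
theorem dGamma_sum {κ : Type*} (s : Finset κ) (A : κ → Matrix ι ι ℂ) :
    dGamma (∑ k ∈ s, A k) = ∑ k ∈ s, dGamma (A k) := by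
  classical
  induction s using Finset.induction_on with
  | empty => rw [sum_empty, sum_empty, dGamma_eq]; simp
  | insert a s ha ih => rw [sum_insert ha, sum_insert ha, dGamma_add, ih]

-- `dGamma_sub` (dΓ respects subtraction) is the tree's `FreeFermionTwistedTraceFormula.dGamma_sub` (reused).

/-- `S⁺ − S⁻ = dΓ(J)`. [cite: RodriguezGuzmanEtAl2012, §II eq. (5)] -/
theorem spinPlus_sub_spinMinus_eq_dGamma :
    (spinPlus - spinMinus : Matrix (Finset (Orb Λ)) (Finset (Orb Λ)) ℂ) = dGamma spinYOneBody := by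
  rw [spinYOneBody, dGamma_sum, spinPlus, spinMinus_eq_sum, ← sum_sub_distrib]
  refine sum_congr rfl fun x _ => ?_
  rw [dGamma_sub, dGamma_single, dGamma_single, one_smul, one_smul]

omit [LinearOrder Λ] [Fintype Λ] in
/-- The two spin orbitals of a site are distinct. [folklore] -/
private theorem orb_zero_ne_one' (x : Λ) : orb x 0 ≠ orb x 1 := by
  intro h
  have h2 := congrArg (fun o : Orb Λ => (ofLex o).2) h
  simp at h2

omit [LinearOrder Λ] [Fintype Λ] in
/-- Orbitals of different sites are distinct. [folklore] -/
private theorem orb_ne_orb' {x y : Λ} (hxy : x ≠ y) (σ τ : Fin 2) : orb x σ ≠ orb y τ := by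
  intro h
  exact hxy (congrArg (fun o : Orb Λ => (ofLex o).1) h)

/-- The one-site generator `J_x = E_{x↑,x↓} − E_{x↓,x↑}`. [folklore] -/
private def siteJ (x : Λ) : Matrix (Orb Λ) (Orb Λ) ℂ :=
  Matrix.single (orb x 0) (orb x 1) (1 : ℂ) - Matrix.single (orb x 1) (orb x 0) (1 : ℂ)

/-- `J = Σ_x J_x`. [folklore] -/
private theorem spinYOneBody_eq_sum : (spinYOneBody : Matrix (Orb Λ) (Orb Λ) ℂ) = ∑ x, siteJ x := rfl

/-- `J_x J_y = 0` for `x ≠ y`. [folklore] -/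
private theorem siteJ_mul_siteJ_of_ne {x y : Λ} (hxy : x ≠ y) : siteJ x * siteJ y = 0 := by
  rw [siteJ, siteJ, sub_mul, mul_sub, mul_sub, Matrix.single_mul_single_of_ne (h := orb_ne_orb' hxy 1 0),
    Matrix.single_mul_single_of_ne (h := orb_ne_orb' hxy 1 1),
    Matrix.single_mul_single_of_ne (h := orb_ne_orb' hxy 0 0),
    Matrix.single_mul_single_of_ne (h := orb_ne_orb' hxy 0 1), sub_zero, sub_zero]

/-- `J_x² = −(E_{x↑,x↑} + E_{x↓,x↓})`. [folklore] -/
private theorem siteJ_mul_siteJ_self (x : Λ) :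
    siteJ x * siteJ x = -(Matrix.single (orb x 0) (orb x 0) (1 : ℂ) + Matrix.single (orb x 1) (orb x 1) (1 : ℂ)) := by
  rw [siteJ, sub_mul, mul_sub, mul_sub, Matrix.single_mul_single_of_ne (h := (orb_zero_ne_one' x).symm),
    Matrix.single_mul_single_same, Matrix.single_mul_single_same,
    Matrix.single_mul_single_of_ne (h := orb_zero_ne_one' x), mul_one]
  abel

omit [LinearOrder Λ] in
/-- Sums over orbitals as iterated sums over sites and spins. [folklore] -/
private theorem sum_orb_eq {β : Type*} [AddCommMonoid β] (f : Orb Λ → β) :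
    ∑ o, f o = ∑ x : Λ, ∑ σ : Fin 2, f (orb x σ) := by
  rw [← Fintype.sum_prod_type', ← (toLex : Λ × Fin 2 ≃ Orb Λ).sum_comp]

/-- `Σ_o E_{oo} = 1`. [folklore] -/
private theorem sum_single_diag_eq_one : ∑ o : Orb Λ, Matrix.single o o (1 : ℂ) = 1 := by
  ext i j
  simp only [Matrix.sum_apply, Matrix.single_apply, Matrix.one_apply]
  by_cases hij : i = j
  · subst hij; simp
  · rw [if_neg hij]
    exact Finset.sum_eq_zero fun o _ => by
      rw [if_neg]
      rintro ⟨rfl, rfl⟩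
      exact hij rfl

/-- `J² = −1`: on each site `J` is the real antisymmetric `2 × 2` generator. [folklore] -/
private theorem spinYOneBody_mul_self : (spinYOneBody : Matrix (Orb Λ) (Orb Λ) ℂ) * spinYOneBody = -1 := by
  rw [spinYOneBody_eq_sum, sum_mul_sum, ← sum_single_diag_eq_one, sum_orb_eq, ← sum_neg_distrib]
  refine sum_congr rfl fun x _ => ?_
  rw [sum_eq_single_of_mem x (mem_univ x) (fun y _ hyx => siteJ_mul_siteJ_of_ne (Ne.symm hyx)),
    siteJ_mul_siteJ_self, Fin.sum_univ_two]

/-- `exp(θJ) = cos θ · 1 + sin θ · J` for an element with `J² = −1` of a complete normed algebra (the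
exponential series summed in even and odd parts). [folklore] -/
private theorem exp_smul_of_mul_self_eq_neg_one {A : Type*} [NormedRing A] [NormedAlgebra ℂ A]
    [CompleteSpace A] {J : A} (hJ : J * J = -1) (θ : ℂ) :
    NormedSpace.exp (θ • J) = Complex.cos θ • (1 : A) + Complex.sin θ • J := by
  have hJ2 : ∀ k : ℕ, J ^ (2 * k) = ((-1 : ℂ) ^ k) • (1 : A) := by
    intro k
    rw [pow_mul, sq, hJ, ← neg_one_smul ℂ (1 : A), smul_pow, one_pow]
  have hJ2' : ∀ k : ℕ, J ^ (2 * k + 1) = ((-1 : ℂ) ^ k) • J := by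
    intro k
    rw [pow_succ, hJ2, smul_mul_assoc, one_mul]
  have he : HasSum (fun k : ℕ => (((Nat.factorial (2 * k) : ℕ) : ℂ)⁻¹) • (θ • J) ^ (2 * k))
      (Complex.cos θ • (1 : A)) := by
    convert (Complex.hasSum_cos θ).smul_const (1 : A) using 1
    funext k
    rw [smul_pow, hJ2, smul_smul, smul_smul]
    congr 1
    rw [div_eq_mul_inv]
    ring
  have ho : HasSum (fun k : ℕ => (((Nat.factorial (2 * k + 1) : ℕ) : ℂ)⁻¹) • (θ • J) ^ (2 * k + 1))
      (Complex.sin θ • J) := by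
    convert (Complex.hasSum_sin θ).smul_const J using 1
    funext k
    rw [smul_pow, hJ2', smul_smul, smul_smul]
    congr 1
    rw [div_eq_mul_inv]
    ring
  have hall := HasSum.even_add_odd (f := fun n : ℕ => (((Nat.factorial n : ℕ) : ℂ)⁻¹) • (θ • J) ^ n) he ho
  exact (NormedSpace.exp_series_hasSum_exp' (𝕂 := ℂ) (θ • J)).unique hall

/-- Concrete instance of the previous lemma for the one-body generator `J` (stated with the default
matrix instances, proved under the `L^∞` operator norm). [folklore] -/
private theorem exp_smul_spinYOneBody (θ : ℂ) :
    NormedSpace.exp (θ • (spinYOneBody : Matrix (Orb Λ) (Orb Λ) ℂ)) =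
      Complex.cos θ • (1 : Matrix (Orb Λ) (Orb Λ) ℂ) + Complex.sin θ • spinYOneBody := by
  open scoped Matrix.Norms.Operator in
  exact exp_smul_of_mul_self_eq_neg_one spinYOneBody_mul_self θ

/-- **The global spin rotation is a second quantisation**: `e^{−iβS_y} = R_y(β) = Γ(cos(β/2)·1 − sin(β/2)·J)`,
the second quantisation of the one-body rotation acting as `[[cos β/2, −sin β/2],[sin β/2, cos β/2]]` on every
site's spinor `(c†_{x↑}, c†_{x↓})` — the "spin-rotated orbital matrices" of the projected-determinant
certificates. [cite: RodriguezGuzmanEtAl2012, §II eq. (5) and App. A] [cite: BratteliRobinsonII1997, §5.2.2, Thm. 5.2.5] -/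
theorem spinRotY_eq_Gamma (β : ℂ) :
    (LowdinProjection.spinRotY (Complex.cos (β / 2)) (Complex.sin (β / 2)) :
        Matrix (Finset (Orb Λ)) (Finset (Orb Λ)) ℂ) =
      Gamma (Complex.cos (β / 2) • (1 : Matrix (Orb Λ) (Orb Λ) ℂ) - Complex.sin (β / 2) • spinYOneBody) := by
  rw [LowdinProjection.spinRotY_eq_exp, spinPlus_sub_spinMinus_eq_dGamma, ← dGamma_smul,
    exp_dGamma_eq_Gamma_exp, exp_smul_spinYOneBody, Complex.cos_neg, Complex.sin_neg, neg_smul,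
    ← sub_eq_add_neg]

variable (G : SimpleGraph Λ) [DecidableRel G.Adj]

/-- **Symmetry-rotated kernels are determinant-pair kernels.** For an orbital permutation `π` (lattice
symmetry operation `U_π`) and the spin rotation `R_y(β)`, the kernel of the Hubbard Hamiltonian between
`Φ_g` and `U_π R_y(β) Φ_h` is the kernel between `Φ_g` and the Slater determinant of the transformed orbital
matrix `P_π (cos(β/2)·1 − sin(β/2)·J) h` — to which `hubbard_kernel_eq` applies verbatim.
[cite: RodriguezGuzmanEtAl2012, App. A] -/
theorem hubbard_kernel_perm_spinRot (g h : Matrix (Orb Λ) (Orb Λ) ℂ) (T : Finset (Orb Λ)) (t U : ℝ)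
    (π : Equiv.Perm (Orb Λ)) (β : ℂ) :
    star ((Gamma g).col T) ⬝ᵥ (hamiltonian G t U *ᵥ ((fockRelabel π).val *ᵥ
        (LowdinProjection.spinRotY (Complex.cos (β / 2)) (Complex.sin (β / 2)) *ᵥ (Gamma h).col T))) =
      star ((Gamma g).col T) ⬝ᵥ (hamiltonian G t U *ᵥ
        (Gamma (permOneBody π * (Complex.cos (β / 2) • (1 : Matrix (Orb Λ) (Orb Λ) ℂ) -
          Complex.sin (β / 2) • spinYOneBody) * h)).col T) := by
  rw [fockRelabel_val_eq_Gamma, spinRotY_eq_Gamma, Gamma_mulVec_col_Gamma, Gamma_mulVec_col_Gamma,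
    ← Matrix.mul_assoc]

/-- The same for the overlap kernel: `⟨Φ_g, U_π R_y(β) Φ_h⟩ = det ((gᴴ P_π (c·1 − s·J) h)[T,T])`.
[cite: RodriguezGuzmanEtAl2012, App. A] -/
theorem overlap_perm_spinRot_eq_det (g h : Matrix (Orb Λ) (Orb Λ) ℂ) {T : Finset (Orb Λ)} {k : ℕ}
    (hT : T.card = k) (π : Equiv.Perm (Orb Λ)) (β : ℂ) :
    star ((Gamma g).col T) ⬝ᵥ ((fockRelabel π).val *ᵥ
        (LowdinProjection.spinRotY (Complex.cos (β / 2)) (Complex.sin (β / 2)) *ᵥ (Gamma h).col T)) =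
      (overlapMatrix g (permOneBody π * (Complex.cos (β / 2) • (1 : Matrix (Orb Λ) (Orb Λ) ℂ) -
          Complex.sin (β / 2) • spinYOneBody) * h) T hT).det := by
  rw [fockRelabel_val_eq_Gamma, spinRotY_eq_Gamma, Gamma_mulVec_col_Gamma, Gamma_mulVec_col_Gamma,
    ← Matrix.mul_assoc, overlap_eq_det_overlapMatrix]

end Spin

end SlaterKernel

end Literature.MathematicalPhysics.QuantumLattice
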